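import Summits.QuantumFields.YangMills.Theorems.UnitScaleTiltHistoryTailTowerReach
import Literature.MathematicalPhysics.QuantumFieldTheory.Balaban1983to89.T3AlphaInputsACSchemas
import HarnessLib

/-!
# Crux-ideation sketch (gen 4) — card `clean-history-insertion` for crux `HistoryTailL` (stmt-QuantumFields-19936; parent `HistoryTail`
# stmt-QuantumFields-18916), route `UnitScaleTilt`, seat `ym-cruxidea-18916-2`

Target (registered state 03:20Z, owner ruling g17-№4): the load-bearing stub of `HistoryTailL` is v5q's STUB A `BirthV5q.stub_jointRateHigh`
(`Cruxes/HistoryTailL/Lines/birth_v5q.lean` 49ed60284f46d339) — the DATUM-FREE joint dilute bound `Gibbs_K(E_S) ≤ e^{−¼p_j²|S| + C·x_j·N_j³}` for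
`ccol·x_j^{r₀}`-separated families — whose HOW is the second line v5p3 (`Lines/birth_v5p3.lean`: the `|S|`-tilt `∫_{E_S} up_j ≤ … ·∫ low_j` over the
(α)-lane's windowed datum via 4a `stub_historyMassBound`, 4b `stub_lowMass`, 4c `stub_diluteExponent`; the withdrawn v5pp cut
`stub_historyBoundOfLaneConcrete` 606226de19384dd0 was the same inequality over the unwindowed datum).  In all of them the members of the chessboard
family `S` may sit in the HOLES of a history (`q ∉ Ω_j(h)`), where no small factor of [Balaban1985UV3] (71) is attributable to `q`; the lead's 4c pays
for such members out of the excess `¼p_i² − ¼p_j² ≥ σ(i,j)` of the hole's generator, which forces the collar-sized separation `ccol·x_j^{r₀}` and the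
«collars vs cells» geometry now being built (LaneTowerReach p489534, CornerBlocks p489892, Clusters p490810, ZCount p491081).

THE LEVER OF THIS CARD.  Bałaban's restricted densities `ρ^S_j = T_{j−1}⋯T_0(𝟙_S e^{−β_K A})` (`T3RestrictedUnitDensity.resDensity F γ K S j`, in the
tree, with the push-forward identity `integral_resDensity_mul`) for the CLEAN-NEIGHBOURHOOD event `S = cleanSet Z` («every averaged field `Ū^i`, `i < j`,
is `θBal(K−i)`-small on the zone `Z_i`»): since the lane's characteristic functions are SHARP and its step threshold IS `θBal(K−i)`
(`AlphaInputsT3ACv2RecData.dataT3c_chi_eq`, `Cχ = 1`), the insertion `𝟙_{cleanSet Z}` kills every term of (41) whose history has a large-field plaquette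
in the zone ((7) p.257: `ζ_p·χ_p = 0`) and is `≤ 1` on the others — the row `Ineq41InsertAE` below, whose two extreme cases (`Z = ∅`: `Ineq41AE`;
`Z` = everything: the lane's `Ineq41RestrictedAE`) are already theorems-modulo-(α) of the lane.  On the surviving CLEAN histories every member of `S`
has its fine box inside `Ω_j(h)` (`CleanInterior`, the contrapositive of `HistoryTailTowerReach.exists_source_within_reach`), so the LANDED
`HistoryTailAlphaTopFamily.card_mul_quarter_le_mainT_of_separated` gives `|S|·¼p_j² ≤ mainT_j(h, W)` with separation `18`, for EVERY contributing
history — theorem `card_mul_quarter_le_mainT_of_clean` below (PROVED).  The dirty part of the one-plaquette event is a finite union of large-plaquette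
events of FINER levels `i < j` near `p`, whose tails are the same theorem at level `i` with the much larger `p_i = b₀x_i^{p₀}`, `x_i = x_j + (j−i)·log √L`:
the first-dirty-scale recursion `T(j) ≤ A(j) + Σ_{i<j} n(j,i)·T(i)` closes by strong induction (`le_two_mul_of_recursion`, PROVED) because
`L^{3(j−i)}·e^{−c(p_i² − p_j²)}` is summable.

Contents: §1 the clean event and the decomposition of the one-plaquette event (PROVED); §2 the abstract recursion (PROVED); §3 the restricted
history sums `upOn`, the clean classes `cleanRegs`, the row `Ineq41InsertAE` and its `Z = ∅` sanity check against `Ineq41AE` (PROVED); §4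
`CleanInterior` and the small factors of a clean family (PROVED from the landed top-family theorem); §5 the transferred stub `CleanDiluteBound`
(statement only: separation `18`, clean classes) — the S-FREE resummation it reduces to is the lead's 4a at `S = ∅` plus 4b; §6 the DATUM-FREE
Gibbs-level twin registrable today: `CleanJointRate` (STUB A′, `18`-separated families, clean joint event) and `CleanChessboard` (RP for the
cell-local composite event), with `ballZone` / `zoneRadius` in the currency of `HistoryTailTowerReach` and the identity `cleanSet_zoneOf` (PROVED).
No `sorry`; nothing here is landed; the defs are hypothesis schemas / statements, never asserted.

References: T. Bałaban, CMP 102 (1985) 255–275 [Balaban1985UV3] ((5) p.256, (7) p.257, (38)–(41) p.266, (47) p.267, (67)–(71) p.273);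
T. Bałaban, CMP 122 (1989) 175–202 (doi:10.1007/bf01257412) p.181; J. Dimock, arXiv:1212.5562 p.3.
-/

noncomputable section

open MeasureTheory
open scoped BigOperators Classical
open Literature.MathematicalPhysics.QuantumFieldTheory.Balaban1983to89
open Literature.MathematicalPhysics.QuantumFieldTheory.Balaban1983to89.T3ContinuumYM3Torus
open Literature.MathematicalPhysics.QuantumFieldTheory.Balaban1983to89.T3UnitScaleTilt
open Literature.MathematicalPhysics.QuantumFieldTheory.Balaban1983to89.T3UnitLawDensityEML
open Literature.MathematicalPhysics.QuantumFieldTheory.Balaban1983to89.T3AlphaInputsAC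
open Literature.MathematicalPhysics.QuantumFieldTheory.Balaban1983to89.T3AlphaInputsACSchemas
open Literature.MathematicalPhysics.QuantumFieldTheory.Balaban1983to89.T3RestrictedUnitDensity
open B10Eq38TorusDomains (toFine cornerSet)
open Summit.QuantumFields.YangMills.Theorems
open Summit.QuantumFields.YangMills.Theorems.HistoryTailAlphaTopFamily (card_mul_quarter_le_mainT_of_separated)

namespace Summit.QuantumFields.YangMills.Cruxes.HistoryTail.Ideas18916i2Clean

variable {F : T3Family} {γ : ℝ}

/-! ## §1 The clean-neighbourhood event and the decomposition of the one-plaquette event -/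

/-- The large-plaquette event of the `i`-fold EML-averaged field of run `K` at the level-`i` plaquette `q`, threshold `θBal(K−i)` (verbatim the
event of the per-plaquette stub, at every level). [cite: Balaban1985UV3, (7) p.257] -/
def largeAt (F : T3Family) (γ b₀ p₀ : ℝ) (K i : ℕ) (q : Plaq (F.P K) i) :
    Set (GaugeField (F.P K) 0 (Matrix.specialUnitaryGroup (Fin 2) ℂ)) :=
  {U | θBal F.L γ b₀ p₀ (K - i) ≤
    GaugeGroup.dist1 (GaugeField.plaqHol (Averaging.iter (fun _ => BlockAveraging.blockAvg ℰp) i U) q)}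

/-- **THE CLEAN-NEIGHBOURHOOD EVENT** of a zone `Z = (Z_i)_{i}` (finite sets of plaquettes of the levels `i < j`): every averaged field `Ū^i`,
`i < j`, is `θBal(K−i)`-SMALL on `Z_i` — a measurable event of the FINE field (the averages are functions of `U`).  With the lane's sharp
characteristic functions at threshold `θBal(K−i)` (`dataT3c_chi_eq`), `𝟙_{cleanSet Z}·ζ_{P_i} = 0` whenever `P_i ∩ Z_i ≠ ∅`. [cite: Balaban1985UV3, (7) p.257] -/
def cleanSet (F : T3Family) (γ b₀ p₀ : ℝ) (K j : ℕ) (Z : (i : ℕ) → Finset (Plaq (F.P K) i)) :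
    Set (GaugeField (F.P K) 0 (Matrix.specialUnitaryGroup (Fin 2) ℂ)) :=
  {U | ∀ i < j, ∀ q ∈ Z i, GaugeGroup.dist1 (GaugeField.plaqHol (Averaging.iter (fun _ => BlockAveraging.blockAvg ℰp) i U) q) <
    θBal F.L γ b₀ p₀ (K - i)}

/-- The empty zone is no condition. -/
theorem cleanSet_empty (F : T3Family) (γ b₀ p₀ : ℝ) (K j : ℕ) :
    cleanSet F γ b₀ p₀ K j (fun _ => ∅) = Set.univ := by
  ext U
  simp [cleanSet]

/-- **FIRST-DIRTY-SCALE DECOMPOSITION** (set algebra): a large level-`j` plaquette is either large WITH a clean zone, or some plaquette of the zone at a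
finer level `i < j` is itself large at ITS threshold. [cite: Balaban1985UV3, (7) p.257] -/
theorem largeAt_subset_clean_union (b₀ p₀ : ℝ) (K j : ℕ) (Z : (i : ℕ) → Finset (Plaq (F.P K) i)) (p : Plaq (F.P K) j) :
    largeAt F γ b₀ p₀ K j p ⊆ (largeAt F γ b₀ p₀ K j p ∩ cleanSet F γ b₀ p₀ K j Z) ∪
      ⋃ i ∈ Finset.range j, ⋃ q ∈ Z i, largeAt F γ b₀ p₀ K i q := by
  intro U hU
  by_cases hc : U ∈ cleanSet F γ b₀ p₀ K j Z
  · exact Or.inl ⟨hU, hc⟩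
  · right
    simp only [cleanSet, Set.mem_setOf_eq, not_forall, not_lt] at hc
    obtain ⟨i, hi, q, hq, hle⟩ := hc
    simp only [Set.mem_iUnion, Finset.mem_range]
    exact ⟨i, hi, q, hq, hle⟩

/-- **THE UNION BOUND OF THE DECOMPOSITION** for any finite measure (the Gibbs measure `gibbsK F ℰp γ K` in the application):
`μ(E_p^{(j)}) ≤ μ(E_p^{(j)} ∩ clean) + Σ_{i<j} Σ_{q ∈ Z_i} μ(E_q^{(i)})`. [folklore] -/
theorem measureReal_largeAt_le {K : ℕ} (μ : Measure (GaugeField (F.P K) 0 (Matrix.specialUnitaryGroup (Fin 2) ℂ))) [IsFiniteMeasure μ]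
    (b₀ p₀ : ℝ) (j : ℕ) (Z : (i : ℕ) → Finset (Plaq (F.P K) i)) (p : Plaq (F.P K) j) :
    μ.real (largeAt F γ b₀ p₀ K j p) ≤ μ.real (largeAt F γ b₀ p₀ K j p ∩ cleanSet F γ b₀ p₀ K j Z) +
      ∑ i ∈ Finset.range j, ∑ q ∈ Z i, μ.real (largeAt F γ b₀ p₀ K i q) := by
  calc μ.real (largeAt F γ b₀ p₀ K j p)
      ≤ μ.real ((largeAt F γ b₀ p₀ K j p ∩ cleanSet F γ b₀ p₀ K j Z) ∪
          ⋃ i ∈ Finset.range j, ⋃ q ∈ Z i, largeAt F γ b₀ p₀ K i q) :=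
        measureReal_mono (largeAt_subset_clean_union b₀ p₀ K j Z p)
    _ ≤ μ.real (largeAt F γ b₀ p₀ K j p ∩ cleanSet F γ b₀ p₀ K j Z) +
          μ.real (⋃ i ∈ Finset.range j, ⋃ q ∈ Z i, largeAt F γ b₀ p₀ K i q) := measureReal_union_le _ _
    _ ≤ _ := by
        have hU : μ.real (⋃ i ∈ Finset.range j, ⋃ q ∈ Z i, largeAt F γ b₀ p₀ K i q) ≤
            ∑ i ∈ Finset.range j, ∑ q ∈ Z i, μ.real (largeAt F γ b₀ p₀ K i q) :=
          calc μ.real (⋃ i ∈ Finset.range j, ⋃ q ∈ Z i, largeAt F γ b₀ p₀ K i q)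
              ≤ ∑ i ∈ Finset.range j, μ.real (⋃ q ∈ Z i, largeAt F γ b₀ p₀ K i q) := measureReal_biUnion_finset_le _ _
            _ ≤ ∑ i ∈ Finset.range j, ∑ q ∈ Z i, μ.real (largeAt F γ b₀ p₀ K i q) :=
                Finset.sum_le_sum fun i _ => measureReal_biUnion_finset_le _ _
        linarith

/-! ## §2 The first-dirty-scale recursion closes by strong induction -/

/-- **THE RECURSION LEMMA**: if `T(j) ≤ A(j) + Σ_{i<j} n(j,i)·T(i)` with `n ≥ 0`, `A ≤ B`, and the budget `Σ_{i<j} n(j,i)·2B(i) ≤ B(j)`, then `T ≤ 2B`.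
In the application `T(j) = sup_p gibbsK(E_p^{(j)})`, `A(j)` = the clean part (bounded through the clean chessboard and `CleanDiluteBound` by
`B(j) = C·e^{−c·p_j² + κ·x_j^{1+3r₀}}`), `n(j,i) = #Z_i ≤ 3(4dρ·L^{j−i} + 1)³` (`HistoryTailTowerReach.ncard_levelSites_near_le`), and the budget holds for
`x_j ≥ x₀(b₀, p₀, κ, ρ, L)` because `p_i² − p_j² ≥ b₀²·x_i^{2p₀−1}(x_i − x_j)`, `x_i − x_j = (j − i)·log √L`, `2p₀ − 1 > 3r₀`. [folklore] -/
theorem le_two_mul_of_recursion {T A B : ℕ → ℝ} {n : ℕ → ℕ → ℝ} (hn : ∀ j i, 0 ≤ n j i)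
    (hT : ∀ j, T j ≤ A j + ∑ i ∈ Finset.range j, n j i * T i) (hA : ∀ j, A j ≤ B j)
    (hB : ∀ j, ∑ i ∈ Finset.range j, n j i * (2 * B i) ≤ B j) : ∀ j, T j ≤ 2 * B j := by
  intro j
  induction j using Nat.strong_induction_on with
  | _ j ih =>
    calc T j ≤ A j + ∑ i ∈ Finset.range j, n j i * T i := hT j
      _ ≤ B j + ∑ i ∈ Finset.range j, n j i * (2 * B i) :=
          add_le_add (hA j) (Finset.sum_le_sum fun i hi => mul_le_mul_of_nonneg_left (ih i (Finset.mem_range.mp hi)) (hn j i))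
      _ ≤ B j + B j := by linarith [hB j]
      _ = 2 * B j := by ring

/-! ## §3 Restricted history sums and the row «(41) with a small-field insertion» -/

variable {D : AlphaDataT3 F γ}

/-- **THE HISTORY SUM OF (41) RESTRICTED TO A CLASS `𝒞` OF REGION HISTORIES**: `Σ_{r ∈ 𝒞} ∫ wt(r,v,W)·exp(−mainT + Pint + Zterm)(assemble r v) dv`
(`LFSum`'s right side with the exponent of `AlphaDataT3.up`, summed over `𝒞` only). [cite: Balaban1985UV3, (41) p.266] -/
def upOn (ℓ : LFData D) (K j : ℕ) (𝒞 : Finset (ℓ.Reg K j)) (W : GaugeField (F.P K) j (Matrix.specialUnitaryGroup (Fin 2) ℂ)) : ℝ :=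
  ∑ r ∈ 𝒞, ∫ v, ℓ.wt K j r v W *
      Real.exp (-(D.mainT K j (ℓ.assemble K j r v) W) + D.Pint K j (ℓ.assemble K j r v) W + D.Zterm K j (ℓ.assemble K j r v))
    ∂Measure.pi fun i : Fin j => fieldMeasure (F.P K) (i : ℕ) (Matrix.specialUnitaryGroup (Fin 2) ℂ)

/-- Under `LFSum` the full class gives back `up_j`. [cite: Balaban1985UV3, (41) p.266] -/
theorem up_eq_upOn_univ {ℓ : LFData D} (h : LFSum D ℓ) (K j : ℕ) (W : GaugeField (F.P K) j (Matrix.specialUnitaryGroup (Fin 2) ℂ)) :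
    D.up K j W = upOn ℓ K j (@Finset.univ _ (ℓ.regFintype K j)) W := by
  simp only [AlphaDataT3.up, upOn, h.2.2 K j W]

/-- **THE CLEAN CLASSES**: region histories with NO large-field plaquette of any level `i < j` in the zone. [cite: Balaban1985UV3, (38)-(40) p.266] -/
def cleanRegs (ℓ : LFData D) (K j : ℕ) (Z : (i : ℕ) → Finset (Plaq (F.P K) i)) : Finset (ℓ.Reg K j) :=
  (@Finset.univ _ (ℓ.regFintype K j)).filter fun r => ∀ i < j, Disjoint (ℓ.LargeP K j r i) (Z i)

/-- The empty zone keeps every history. -/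
theorem cleanRegs_empty (ℓ : LFData D) (K j : ℕ) :
    cleanRegs ℓ K j (fun _ => ∅) = @Finset.univ _ (ℓ.regFintype K j) := by
  classical
  unfold cleanRegs
  exact Finset.filter_true_of_mem fun r _ => fun i _ => Finset.disjoint_empty_right _

/-- The trivial region history is clean for every zone, provided it has no large-field plaquettes (as in print: `Z_i = ∅` for all `i`). -/
theorem trivReg_mem_cleanRegs (ℓ : LFData D) (K j : ℕ) (htriv : ∀ i, ℓ.LargeP K j (ℓ.trivReg K j) i = ∅)
    (Z : (i : ℕ) → Finset (Plaq (F.P K) i)) : ℓ.trivReg K j ∈ cleanRegs ℓ K j Z := by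
  classical
  unfold cleanRegs
  rw [Finset.mem_filter]
  exact ⟨@Finset.mem_univ _ (ℓ.regFintype K j) _, fun i _ => by rw [htriv i]; exact Finset.disjoint_empty_left _⟩

/-- **ROW «(41) WITH A SMALL-FIELD INSERTION», a.e.** (hypothesis schema on the lane's datum and its opened history functional, never asserted):
for every zone `Z`, the level-`j` density of the Gibbs measure RESTRICTED to the clean event, `ρ^{cleanSet Z}_j`, is at most `e^{−E_j + Rm_j}` times the
(41) history sum over the CLEAN classes only — (41) p.266 proved along the same induction with the factor `𝟙_{cleanSet Z} = Π_{i<j} Π_{q ∈ Z_i} χ(|Ū^i(∂q) − 1| <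
θBal(K−i))` carried: at step `i` it annihilates the terms with `P_i ∩ Z_i ≠ ∅` (sharp partition of unity (7) p.257, `ζχ = 0`) and is bounded by `1` on
the rest.  Extreme cases in the tree: `Z = ∅` is `Ineq41AE` (`ineq41AE_of_insert` below); `Z` = all plaquettes is the lane's `Ineq41RestrictedAE`
(`Balaban3D.Proofs.RestrictedResidualsAlpha`). [cite: Balaban1985UV3, (7) p.257 and (41) p.266] -/
def Ineq41InsertAE (D : AlphaDataT3 F γ) (ℓ : LFData D) (b₀ p₀ : ℝ) (K j : ℕ) : Prop :=
  ∀ Z : (i : ℕ) → Finset (Plaq (F.P K) i),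
    ∀ᵐ W ∂fieldMeasure (F.P K) j (Matrix.specialUnitaryGroup (Fin 2) ℂ),
      resDensity F γ K (cleanSet F γ b₀ p₀ K j Z) j W ≤ Real.exp (-(D.Ecst K j) + D.Rm K j) * upOn ℓ K j (cleanRegs ℓ K j Z) W

/-- Sanity: the insertion row at the empty zone is the delivered `Ineq41AE`. [cite: Balaban1985UV3, (41) p.266] -/
theorem ineq41AE_of_insert {ℓ : LFData D} (hLF : LFSum D ℓ) {b₀ p₀ : ℝ} {K j : ℕ} (h : Ineq41InsertAE D ℓ b₀ p₀ K j) :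
    Ineq41AE D K j := by
  have h0 := h fun _ => ∅
  rw [cleanSet_empty, cleanRegs_empty] at h0
  filter_upwards [h0] with W hW
  rwa [← up_eq_upOn_univ hLF K j W] at hW

/-! ## §4 Clean histories keep the family in the top region: the small factors of a clean family are Bałaban's own (71) -/

/-- The fine box of radius `8L^j` around the base of a level-`j` plaquette (hypothesis (a) of `card_mul_quarter_le_mainT_of_separated`). -/
def fineBox (K j : ℕ) (q : Plaq (F.P K) j) : Set (Site (F.P K) 0) :=
  {x : Site (F.P K) 0 | ∀ ι, ∃ e : ℤ, |e| ≤ 8 * ((F.P K).L : ℤ) ^ j ∧ x ι = toFine j q.src ι + (e : ZMod ((F.P K).sitesPerDir 0))}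

/-- **CLEAN ⇒ INTERIOR** (hypothesis schema for a zone map `zone q = (zone q i)_i`, never asserted): a region history with no large-field plaquette of any
level `i < j` in the zone of `q` has the fine box of `q` inside its top region `Ω_j`.  For the lane's rule-generated regions and the zone «level-`i`
plaquettes with a corner within fine `ℓ¹`-distance `3(R₁(max 1 r₀)^{r₀}x_j^{r₀} + 2d)M₁L^j + 8dL^j` of `toFine j q.src`» this is the contrapositive of
`HistoryTailTowerReach.exists_source_within_reach`. [cite: Balaban1985UV3, (39) p.266] -/
def CleanInterior (ℓ : LFData D) (K j : ℕ) (zone : Plaq (F.P K) j → (i : ℕ) → Finset (Plaq (F.P K) i)) : Prop :=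
  ∀ (r : ℓ.Reg K j) (v : (i : Fin j) → GaugeField (F.P K) i (Matrix.specialUnitaryGroup (Fin 2) ℂ)) (q : Plaq (F.P K) j),
    (∀ i < j, Disjoint (ℓ.LargeP K j r i) (zone q i)) → fineBox K j q ⊆ D.Ω K j (ℓ.assemble K j r v) j

/-- The zone of a family: the union of the members' zones, level by level. -/
def zoneOf {K j : ℕ} (zone : Plaq (F.P K) j → (i : ℕ) → Finset (Plaq (F.P K) i)) (S : Finset (Plaq (F.P K) j)) (i : ℕ) :
    Finset (Plaq (F.P K) i) :=
  S.biUnion fun q => zone q i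

/-- A history clean for the family's zone is clean for each member's zone. -/
theorem disjoint_zone_of_mem_cleanRegs {ℓ : LFData D} {K j : ℕ} {zone : Plaq (F.P K) j → (i : ℕ) → Finset (Plaq (F.P K) i)}
    {S : Finset (Plaq (F.P K) j)} {r : ℓ.Reg K j} (hr : r ∈ cleanRegs ℓ K j (zoneOf zone S)) {q : Plaq (F.P K) j} (hq : q ∈ S) :
    ∀ i < j, Disjoint (ℓ.LargeP K j r i) (zone q i) := by
  classical
  unfold cleanRegs at hr
  rw [Finset.mem_filter] at hr
  intro i hi
  have h := hr.2 i hi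
  unfold zoneOf at h
  rw [Finset.disjoint_biUnion_right] at h
  exact h q hq

/-- **THE SMALL FACTORS OF A CLEAN FAMILY ARE BAŁABAN'S OWN (71)** (`SU(2)`, `d = 3`): under `MainTermIsAction`, `Constraint42Top`, `Regularity68Levels`,
`CleanInterior` for a zone map, the smallness regime of `θBal(K−j)`, for a family `S` of `θBal(K−j)`-large level-`j` plaquettes pairwise `18`-SEPARATED
(no collar-sized separation) and EVERY region history clean for the family's zone with `(h, W)` admissible: `|S|·¼p(g_{K−j})² ≤ mainT_j(h, W)` — the
landed `card_mul_quarter_le_mainT_of_separated`, its hypothesis (a) discharged by cleanliness.  No member of `S` is in a hole, so no tower counting and no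
`σ`-excess bookkeeping is needed for the top factors. [cite: Balaban1985UV3, (41) p.266 and (71) p.273] -/
theorem card_mul_quarter_le_mainT_of_clean (hγ : 0 < γ) (hγ1 : γ ≤ 1) {b₀ : ℝ} (hb₀ : 0 ≤ b₀) (p₀ : ℝ) {C68 : ℝ} (hC68 : 0 ≤ C68)
    (hM : MainTermIsAction D) (h42 : Constraint42Top D) (h68 : Regularity68Levels D b₀ p₀ C68)
    {ℓ : LFData D} {K j : ℕ} (hjK : j ≤ K) {zone : Plaq (F.P K) j → (i : ℕ) → Finset (Plaq (F.P K) i)} (hCI : CleanInterior ℓ K j zone)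
    (hθ1 : ((((3 + 2) * F.L : ℕ) : ℝ) ^ 2 / 4) * (C68 * θBal F.L γ b₀ p₀ (K - j)) ≤ 1 / 10)
    (hθ2 : 540 * (435 ^ 2 * (C68 * (((3 + 2) * F.L : ℕ) : ℝ) ^ 2 / 4) ^ 4) * θBal F.L γ b₀ p₀ (K - j) ^ 2 ≤ 1 / 4)
    (S : Finset (Plaq (F.P K) j)) (r : ℓ.Reg K j) (hr : r ∈ cleanRegs ℓ K j (zoneOf zone S))
    (v : (i : Fin j) → GaugeField (F.P K) i (Matrix.specialUnitaryGroup (Fin 2) ℂ))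
    (W : GaugeField (F.P K) j (Matrix.specialUnitaryGroup (Fin 2) ℂ)) (hadm : D.Adm K j (ℓ.assemble K j r v) W)
    (hlarge : ∀ q ∈ S, θBal F.L γ b₀ p₀ (K - j) ≤ GaugeGroup.dist1 (GaugeField.plaqHol W q))
    (hsep : ∀ q ∈ S, ∀ q' ∈ S, q ≠ q' → 18 ≤ Site.tdist q.src q'.src) :
    (S.card : ℝ) * ((1 / 4 : ℝ) * B10.pFun b₀ p₀ (Real.sqrt (γ * ((F.L : ℝ)⁻¹) ^ (K - j))) ^ 2) ≤
      D.mainT K j (ℓ.assemble K j r v) W :=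
  card_mul_quarter_le_mainT_of_separated hγ hγ1 hb₀ p₀ hC68 hM h42 h68 hjK (ℓ.assemble K j r v) W hadm hθ1 hθ2 S
    (fun q hq => hCI r v q (disjoint_zone_of_mem_cleanRegs hr hq)) hlarge hsep

/-! ## §5 The transferred stub: the dilute-family tilt on CLEAN classes, separation `18` -/

/-- **THE CLEAN DILUTE BOUND** (statement of the transferred analytic stub C⁺, never asserted): for the lane's datum `D` with opened history functional
`ℓ` and a zone map, uniformly in the run: for every `18`-separated family `S` of level-`j` plaquettes, the (41) history sum over the CLEAN classes,
integrated over the joint large event, is tilted by `e^{−¼p_j²·|S|}` relative to `∫ low_j` up to `e^{C·x_j·N_j³}`.  WHY EASIER than the owner's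
`stub_historyBoundOfLaneConcrete` / the lead's 4c: by `card_mul_quarter_le_mainT_of_clean` the top factors come off `mainT` for every contributing
history with NO interaction between `S` and the history's lower-level structure (zones are disjoint from every `Δ′(p′)`, `p′ ∈ P_i(h)`, by
construction); bounding `𝟙_{E_S} ≤ 1` afterwards and discarding cleanliness leaves the S-FREE tilted mass `Σ_r ∫∫ wt_r e^{−(mainT − |S|¼p²)⁺ + Pint + Zterm}`,
i.e. the lead's `stub_historyMassBound` at `S = ∅` (with the full-strength lower-level factors `¼p_i²` on a disjoint subfamily in place of `σ(i,j)`)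
plus `stub_lowMass`. [cite: Balaban1985UV3, (5) p.256 and (41) p.266 and (71) p.273] -/
def CleanDiluteBound (D : AlphaDataT3 F γ) (ℓ : LFData D) (b₀ p₀ C : ℝ) (K : ℕ)
    (zone : (j : ℕ) → Plaq (F.P K) j → (i : ℕ) → Finset (Plaq (F.P K) i)) : Prop :=
  ∀ j, j ≤ K → ∀ S : Finset (Plaq (F.P K) j), (∀ q ∈ S, ∀ q' ∈ S, q ≠ q' → 18 ≤ Site.tdist q.src q'.src) →
    ∫ W in {W | ∀ q ∈ S, θBal F.L γ b₀ p₀ (K - j) ≤ GaugeGroup.dist1 (GaugeField.plaqHol W q)},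
        upOn ℓ K j (cleanRegs ℓ K j (zoneOf (zone j) S)) W ∂fieldMeasure (F.P K) j (Matrix.specialUnitaryGroup (Fin 2) ℂ) ≤
      Real.exp (-((1 / 4 : ℝ) * B10.pFun b₀ p₀ (Real.sqrt (γ * ((F.L : ℝ)⁻¹) ^ (K - j))) ^ 2) * S.card +
          C * B10LargeField.xlog (Real.sqrt (γ * ((F.L : ℝ)⁻¹) ^ (K - j))) * ((F.P K).sitesPerDir j : ℝ) ^ 3) *
        ∫ W, D.low K j W ∂fieldMeasure (F.P K) j (Matrix.specialUnitaryGroup (Fin 2) ℂ)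

/-! ## §6 The DATUM-FREE twin (registrable today, owner ruling g17-№4 «WHAT, not HOW»): clean joint rate + clean chessboard at Gibbs level

Since 03:20Z the registered large-field stub of `HistoryTailL` is v5q's STUB A `BirthV5q.stub_jointRateHigh` — the joint dilute bound
`Gibbs_K(E_S) ≤ exp(−¼p_j²|S| + C·x_j·N_j³)` for every `ccol·x_j^{r₀}`-SEPARATED family `S`, about the Wilson–Gibbs measure itself; its HOW is the
lead's line v5p3 (4a `stub_historyMassBound`, 4b `stub_lowMass`, 4c `stub_diluteExponent` = the members-in-holes geometry: LaneTowerReach p489534,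
CornerBlocks p489892, Clusters p490810, ZCount p491081).  The clean-insertion line replaces STUB A by the two Gibbs-level statements below — both over
existing declarations, no datum, no weights — and the PROVED recursion of §2:
`CleanChessboard ∧ CleanJointRate ∧ (bounded-height base, landed) ⟹ perPlaquetteHighRaw` (v4 text) `⟹ … ⟹ HistoryTailL` (v5q §2 verbatim). -/

/-- The ZONE of radius `ρ` (fine `ℓ¹` torus units) of a level-`j` plaquette at level `i`: the level-`i` plaquettes with a corner within distance `ρ` of
the base corner of `p` (currency of `HistoryTailTowerReach.exists_source_within_reach`). [cite: Balaban1985UV3, (39) p.266] -/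
def ballZone (K j : ℕ) (ρ : ℝ) (p : Plaq (F.P K) j) (i : ℕ) : Finset (Plaq (F.P K) i) :=
  Finset.univ.filter fun q => ∃ x ∈ cornerSet i q, (Site.tdist x (toFine j p.src) : ℝ) ≤ ρ

/-- The zone radius of the line in level-`j` units: tower reach `3(R₁(max 1 r₀)^{r₀}x^{r₀} + 2d)M₁` plus the box margin `8d`, `d = 3`
(`x = x_j = 1 + log g_{K−j}⁻¹`); it is `≤ czone·x^{r₀}` with `czone = (3R₁(max 1 r₀)^{r₀} + 18)M₁ + 24` because `x ≥ 1`. -/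
def zoneRadius (R₁ r₀ : ℝ) (M₁ : ℕ) (x : ℝ) : ℝ :=
  3 * (R₁ * (max 1 r₀) ^ r₀ * x ^ r₀ + 2 * 3) * M₁ + 8 * 3

/-- **STUB A′ `CleanJointRate` — THE TRANSFERRED CRUX AT GIBBS LEVEL** (statement, never asserted; the text one would register in place of / beside
v5q's `stub_jointRateHigh`): for odd `L ≥ 7` there are a profile `(b₀, p₀)`, a collar exponent `r₀`, a zone constant and `C, γ₁` such that, uniformly in
the run `K` and the level `j > j₀`, for EVERY family `S` of level-`j` plaquettes pairwise `18`-separated (an `x`-FREE separation — the signature of the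
mechanism), the Gibbs probability that all members are `θBal(K−j)`-large AND every averaged field `Ū^{i}`, `i < j`, is `θBal(K−i)`-small on the zone of
`S` is `≤ exp(−¼p_j²·|S| + C·x_j·N_j³)`.  For `czone·x_j^{r₀}`-separated families it is IMPLIED by `stub_jointRateHigh` (smaller event, same right side),
so it is true if STUB A is; its own proof never meets a member in a hole: Mechanism A with the restricted density of the clean event
(`integral_resDensity_mul`, `Ineq41InsertAE`, `Ineq47AE`), `CleanInterior` (tower reach), `card_mul_quarter_le_mainT_of_clean` (§4, PROVED), then the
S-FREE resummation (lead 4a at `S = ∅`) and 4b. [cite: Balaban1985UV3, (5) p.256 and (38)–(41) p.266 and (71) p.273] -/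
def CleanJointRate (L : ℕ) : Prop :=
  Odd L → 7 ≤ L →
    ∃ R₁ r₀ b₀ p₀ C γ₁ : ℝ, ∃ M₁ : ℕ, 0 ≤ R₁ ∧ 0 ≤ r₀ ∧ 0 < b₀ ∧ 2 < p₀ ∧ 1 + 3 * r₀ / 2 < p₀ ∧ 0 ≤ C ∧ 0 < γ₁ ∧ γ₁ ≤ 1 ∧
      ∀ (F : T3Family) (γ : ℝ), F.L = L → 0 < γ → γ ≤ γ₁ →
        ∃ j₀ : ℕ, ∀ (K j : ℕ), j₀ < j → j ≤ K → ∀ S : Finset (Plaq (F.P K) j),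
          (∀ q ∈ S, ∀ q' ∈ S, q ≠ q' → 18 ≤ Site.tdist q.src q'.src) →
          (gibbsK F ℰp γ K).real
              ({U | ∀ q ∈ S, θBal F.L γ b₀ p₀ (K - j) ≤
                  GaugeGroup.dist1 (GaugeField.plaqHol (Averaging.iter (fun _ => BlockAveraging.blockAvg ℰp) j U) q)} ∩
                cleanSet F γ b₀ p₀ K j
                  (zoneOf (fun q => ballZone K j
                    (zoneRadius R₁ r₀ M₁ (B10LargeField.xlog (Real.sqrt (γ * ((F.L : ℝ)⁻¹) ^ (K - j)))) * (F.L : ℝ) ^ j) q) S)) ≤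
            Real.exp (-(B10.pFun b₀ p₀ (Real.sqrt (γ * ((F.L : ℝ)⁻¹) ^ (K - j))) ^ 2 / 4) * (S.card : ℝ) +
              C * B10LargeField.xlog (Real.sqrt (γ * ((F.L : ℝ)⁻¹) ^ (K - j))) * ((F.P K).sitesPerDir j : ℝ) ^ 3)

/-- **STUB `CleanChessboard` — reflection positivity for the CELL-LOCAL composite event** (statement, never asserted): the landed `chessboardRP_T3`
with the one-plaquette event replaced by «`p` is `θBal(K−j)`-large AND the averaged fields below level `j` are small on the zone of `p`», an event
measurable with respect to the fine bonds of a cell of half-width `ρz + 2` level-`j` units around `p`; the mirror images of the zone of `p` are the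
zones of the images (reflections are isometries of the fine torus commuting with every `Averaging.iter blockAvg i`, `T4Covariance.iter_creflect`,
and `dist1` is inversion/conjugation invariant), so the joint event on the right is exactly the clean joint event of `CleanJointRate`.
[cite: FroehlichIsraelLiebSimon1978, Thm 4.1; Balaban1985UV3, (7) p.257] -/
def CleanChessboard (L : ℕ) : Prop :=
  Odd L → 1 < L →
    ∀ (F : T3Family) (γ : ℝ), F.L = L → 0 < γ → γ ≤ 1 → ∀ (b₀ p₀ : ℝ) (K j : ℕ), j ≤ K → ∀ (ρz : ℝ), 1 ≤ ρz →
      ∀ p : Plaq (F.P K) j,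
        ∃ S : Finset (Plaq (F.P K) j), p ∈ S ∧
          (∀ q ∈ S, ∀ q' ∈ S, q ≠ q' → 2 * ρz + 4 ≤ (Site.tdist q.src q'.src : ℝ)) ∧
          (((F.P K).sitesPerDir j : ℝ) ^ 3 ≤ (S.card : ℝ) * (8 * ((F.L : ℝ) * (2 * ρz + 8)) ^ 3)) ∧
          (gibbsK F ℰp γ K).real
              (largeAt F γ b₀ p₀ K j p ∩ cleanSet F γ b₀ p₀ K j (ballZone K j (ρz * (F.L : ℝ) ^ j) p)) ≤
            ((gibbsK F ℰp γ K).real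
                ({U | ∀ q ∈ S, θBal F.L γ b₀ p₀ (K - j) ≤
                    GaugeGroup.dist1 (GaugeField.plaqHol (Averaging.iter (fun _ => BlockAveraging.blockAvg ℰp) j U) q)} ∩
                  cleanSet F γ b₀ p₀ K j (zoneOf (fun q => ballZone K j (ρz * (F.L : ℝ) ^ j) q) S))) ^ ((1 : ℝ) / (S.card : ℝ))

/-- Bookkeeping identity behind both statements: the clean event of a family's zone is the intersection of the members' clean events
(so the right side of `CleanChessboard` is the joint composite event). -/
theorem cleanSet_zoneOf (b₀ p₀ : ℝ) (K j : ℕ) (zone : Plaq (F.P K) j → (i : ℕ) → Finset (Plaq (F.P K) i)) (S : Finset (Plaq (F.P K) j)) :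
    cleanSet F γ b₀ p₀ K j (zoneOf zone S) = {U | ∀ q ∈ S, U ∈ cleanSet F γ b₀ p₀ K j (zone q)} := by
  ext U
  simp only [cleanSet, zoneOf, Finset.mem_biUnion, Set.mem_setOf_eq]
  constructor
  · intro h q hq i hi q' hq'
    exact h i hi q' ⟨q, hq, hq'⟩
  · rintro h i hi q' ⟨q, hq, hq'⟩
    exact h q hq i hi q' hq'

end Summit.QuantumFields.YangMills.Cruxes.HistoryTail.Ideas18916i2Clean

end
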